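import Summits.Ventures.PercRepro.Night2TwoOneGeneralFaces

/-!
# PercRepro — the cell `(2, 1)` with exactly two fat closures, no spread hypothesis: the big-face losses and the
structure of a loaded target (night-2, gen 28)

Continuation of `Night2TwoOneGeneralFaces`.  A set `Q` with a lossy big face is the covering set of a lossy big pair;
it meets each class once, its plane part spans `P` with `≥ 4` points, `L1 Q ≤ 49/60` and the big-face losses sum to at
most `49/60 − 11/18 = 37/180` (**`faceLossP_sum_le_general`**); the structure of `structure_of_faceLossP_ne_zero`
holds without the spread hypothesis (**`structure_general`**).
-/

namespace PercRepro.Shadow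

open Finset PerFlat ThmH

variable {α : Type*} [DecidableEq α] {M : Matroid α} [M.Finite]

section GeneralStructure

variable {G : Finset α}

/-- The plane part of a set meeting each class once spans `P` and has `≥ 4` points when `Q ∖ K` has rank `5` and
`≥ 6` points. -/
theorem plane_part_of_one_per_class {B₀ B₁ Q : Finset α} (hQG : Q ⊆ G) (hQ5 : rkN M (Q \ coloops M G) = 5)
    (hQ6 : 6 ≤ (Q \ coloops M G).card) {u u' : α} (huu' : u ≠ u') (h₀ : Q ∩ (G \ clF M B₀) = {u})
    (h₁ : Q ∩ (G \ clF M B₁) = {u'}) :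
    3 ≤ rkN M (Q ∩ ((clF M B₀ ∩ clF M B₁) \ coloops M G)) ∧
      4 ≤ (Q ∩ ((clF M B₀ ∩ clF M B₁) \ coloops M G)).card := by
  have hsub : Q \ coloops M G ⊆ (Q ∩ ((clF M B₀ ∩ clF M B₁) \ coloops M G)) ∪ {u, u'} := by
    intro x hx
    rw [Finset.mem_sdiff] at hx
    rw [Finset.mem_union, Finset.mem_inter, Finset.mem_sdiff, Finset.mem_inter, Finset.mem_insert,
      Finset.mem_singleton]
    by_cases h0 : x ∈ clF M B₀
    · by_cases h1 : x ∈ clF M B₁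
      · exact Or.inl ⟨hx.1, ⟨h0, h1⟩, hx.2⟩
      · right; right
        have : x ∈ Q ∩ (G \ clF M B₁) := Finset.mem_inter.2 ⟨hx.1, Finset.mem_sdiff.2 ⟨hQG hx.1, h1⟩⟩
        rw [h₁, Finset.mem_singleton] at this
        exact this
    · right; left
      have : x ∈ Q ∩ (G \ clF M B₀) := Finset.mem_inter.2 ⟨hx.1, Finset.mem_sdiff.2 ⟨hQG hx.1, h0⟩⟩
      rw [h₀, Finset.mem_singleton] at this
      exact this
  constructor
  · have h1 := rkN_mono (M := M) hsub
    have h2 := rkN_union_le_add_card (M := M) (Q ∩ ((clF M B₀ ∩ clF M B₁) \ coloops M G)) {u, u'}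
    rw [Finset.card_pair huu'] at h2
    omega
  · have h1 := Finset.card_le_card hsub
    have h2 := Finset.card_union_le (Q ∩ ((clF M B₀ ∩ clF M B₁) \ coloops M G)) {u, u'}
    rw [Finset.card_pair huu'] at h2
    omega

open scoped Classical in
/-- **THE STRUCTURE OF A SET WITH A LOSSY BIG FACE, WITHOUT THE SPREAD HYPOTHESIS** (exactly two fat closures,
disjoint missed pairs): it meets each class once, `K ⊆ Q ⊆ G`, `Q ∖ K` has rank `5` and `≥ 6` points, the plane part
has rank `≥ 3` and `≥ 4` points, `|G ∖ Q| ≥ 4`, and `L1 Q ≤ 49/60`. -/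
theorem structure_general (hG : G ∈ flatsQ M (5 + 1)) (hd : (gr M \ G).card = 2)
    (hk : kColoops M G = 1) (hs : ∀ e ∈ gr M, ∀ f ∈ gr M, e ≠ f → rkN M {e, f} = 2)
    {B₀ B₁ : Finset α} (hB₀ : B₀ ∈ thinMembers M 5 G) (hB₁ : B₁ ∈ thinMembers M 5 G)
    (hm₀ : (G \ clF M B₀).card ≤ 2) (hm₁ : (G \ clF M B₁).card ≤ 2) (hne : clF M B₀ ≠ clF M B₁)
    (hfat : (fatClosures M 5 G 2).card ≤ 2) (hdisj : Disjoint (G \ clF M B₀) (G \ clF M B₁)) {Q : Finset α}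
    (hQ : ∃ w ∈ Q, faceLossP M 5 G (fun B => 5 ≤ (B \ coloops M G).card) Q w ≠ 0) :
    ∃ u u', u ≠ u' ∧ Q ∩ (G \ clF M B₀) = {u} ∧ Q ∩ (G \ clF M B₁) = {u'} ∧ Q ⊆ G ∧ coloops M G ⊆ Q ∧
      rkN M (Q \ coloops M G) = 5 ∧ 6 ≤ (Q \ coloops M G).card ∧
      3 ≤ rkN M (Q ∩ ((clF M B₀ ∩ clF M B₁) \ coloops M G)) ∧
      4 ≤ (Q ∩ ((clF M B₀ ∩ clF M B₁) \ coloops M G)).card ∧ 4 ≤ (G \ Q).card ∧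
      L1 M 5 G Q ≤ 49 / 60 := by
  have hd' : (gr M \ G).card ≤ 5 := by omega
  obtain ⟨w₀, hw₀, hne0⟩ := hQ
  have hcond : Q.erase w₀ ∈ thinMembers M 5 G ∧ 5 ≤ (Q.erase w₀ \ coloops M G).card ∧
      w₀ ∈ G \ clF M (Q.erase w₀) := by
    unfold faceLossP at hne0
    by_contra h
    rw [if_neg h] at hne0
    exact hne0 rfl
  have hloss : loss M 5 G (Q.erase w₀) w₀ ≠ 0 := by
    unfold faceLossP at hne0
    rwa [if_pos hcond] at hne0
  have hQeq : insert w₀ (Q.erase w₀) = Q := Finset.insert_erase hw₀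
  obtain ⟨B, hB⟩ : ∃ B, B = Q.erase w₀ := ⟨_, rfl⟩
  rw [← hB] at hcond hloss hQeq
  have hBU : B ∈ Uq M (5 + 2) 5 := (mem_membersIn.1 (mem_thinMembers.1 hcond.1).1).1
  have hBG : B ⊆ G := (subset_clF hBU).trans (mem_membersIn.1 (mem_thinMembers.1 hcond.1).1).2
  have hKB : coloops M G ⊆ B := coloops_subset_of_mem_thinMembers hG hd' hcond.1
  have hQG : Q ⊆ G := by rw [← hQeq]; exact Finset.insert_subset (Finset.mem_sdiff.1 hcond.2.2).1 hBG
  have hKQ : coloops M G ⊆ Q := by rw [← hQeq]; exact hKB.trans (Finset.subset_insert _ _)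
  have hQK5 : rkN M (Q \ coloops M G) = 5 := by
    rw [← hQeq]; exact rkN_insert_sdiff_coloops_eq_five_of_thin hG hd hk hcond.1 hcond.2.2
  have hw₀B : w₀ ∉ B := notMem_of_notMem_clF hBU (Finset.mem_sdiff.1 hcond.2.2).2
  have hw₀K : w₀ ∉ coloops M G := fun h => hw₀B (hKB h)
  have hQKcard : 6 ≤ (Q \ coloops M G).card := by
    rw [← hQeq, Finset.insert_sdiff_of_notMem _ hw₀K, Finset.card_insert_of_notMem
      (fun h => hw₀B (Finset.mem_sdiff.1 h).1)]
    omega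
  obtain ⟨u, u', h₀, h₁⟩ := one_per_class_of_loss_ne_zero hG hd hk hB₀ hB₁ hm₀ hm₁ hne hfat hdisj hcond.1
    hcond.2.2 hloss
  rw [hQeq] at h₀ h₁
  have huu' : u ≠ u' := by
    intro h
    have hu : u ∈ Q ∩ (G \ clF M B₀) := by rw [h₀]; exact Finset.mem_singleton_self _
    have hu' : u' ∈ Q ∩ (G \ clF M B₁) := by rw [h₁]; exact Finset.mem_singleton_self _
    rw [← h] at hu'
    exact Finset.disjoint_left.1 hdisj (Finset.mem_inter.1 hu).2 (Finset.mem_inter.1 hu').2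
  obtain ⟨hP3, hP4⟩ := plane_part_of_one_per_class hQG hQK5 hQKcard huu' h₀ h₁
  refine ⟨u, u', huu', h₀, h₁, hQG, hKQ, hQK5, hQKcard, hP3, hP4, ?_, ?_⟩
  · -- the complement of the thin face `B = Q ∖ w₀` spans: `|G ∖ Q| + 1 ≥ 5`
    have h5 := five_le_rkN_sdiff_of_mem_Uq_two hG hd hBU hBG
    have hsub : G \ B ⊆ insert w₀ (G \ Q) := by
      intro x hx
      rw [Finset.mem_sdiff] at hx
      rw [Finset.mem_insert, Finset.mem_sdiff]
      by_cases hxw : x = w₀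
      · exact Or.inl hxw
      · right
        refine ⟨hx.1, fun hxQ => hx.2 ?_⟩
        rw [← hQeq, Finset.mem_insert] at hxQ
        rcases hxQ with h | h
        · exact absurd h hxw
        · exact h
    have h1 := rkN_mono (M := M) hsub
    have h2 := rkN_le_card (M := M) (insert w₀ (G \ Q))
    have h3 := Finset.card_insert_le w₀ (G \ Q)
    omega
  · have huQ : u ∈ Q ∩ (G \ clF M B₀) := by rw [h₀]; exact Finset.mem_singleton_self _
    have hu'Q : u' ∈ Q ∩ (G \ clF M B₁) := by rw [h₁]; exact Finset.mem_singleton_self _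
    have hL1 := L1_le_of_spanning' hG hd hk hs hB₀ hB₁ hm₀ hm₁ hne hfat hdisj hQG hP3 hP4 huQ hu'Q
    have hWX : ((Q ∩ ((G \ clF M B₀) ∪ (G \ clF M B₁))).filter
        (fun w => Q.erase w ∈ thinMembers M 5 G)).card ≤ 2 := by
      refine (Finset.card_le_card (Finset.filter_subset _ _)).trans ?_
      rw [Finset.inter_union_distrib_left, h₀, h₁]
      exact Finset.card_le_two
    have hWX' : (((Q ∩ ((G \ clF M B₀) ∪ (G \ clF M B₁))).filter
        (fun w => Q.erase w ∈ thinMembers M 5 G)).card : ℚ) ≤ 2 := by exact_mod_cast hWX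
    nlinarith

open scoped Classical in
/-- **THE BIG-FACE LOSSES OF ANY SET SUM TO AT MOST `37/180`** (exactly two fat closures, disjoint missed pairs, no
spread hypothesis). -/
theorem faceLossP_sum_le_general (hG : G ∈ flatsQ M (5 + 1)) (hd : (gr M \ G).card = 2)
    (hk : kColoops M G = 1) (hs : ∀ e ∈ gr M, ∀ f ∈ gr M, e ≠ f → rkN M {e, f} = 2)
    {B₀ B₁ : Finset α} (hB₀ : B₀ ∈ thinMembers M 5 G) (hB₁ : B₁ ∈ thinMembers M 5 G)
    (hm₀ : (G \ clF M B₀).card ≤ 2) (hm₁ : (G \ clF M B₁).card ≤ 2) (hne : clF M B₀ ≠ clF M B₁)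
    (hfat : (fatClosures M 5 G 2).card ≤ 2) (hdisj : Disjoint (G \ clF M B₀) (G \ clF M B₁)) (Q : Finset α) :
    ∑ w ∈ Q, faceLossP M 5 G (fun B => 5 ≤ (B \ coloops M G).card) Q w ≤ 37 / 180 := by
  have hd' : (gr M \ G).card ≤ 5 := by omega
  by_cases hex : ∃ w ∈ Q, faceLossP M 5 G (fun B => 5 ≤ (B \ coloops M G).card) Q w ≠ 0
  · obtain ⟨-, -, -, -, -, hQG, -, -, -, -, -, -, hL1⟩ :=
      structure_general hG hd hk hs hB₀ hB₁ hm₀ hm₁ hne hfat hdisj hex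
    obtain ⟨w₀, hw₀, hne0⟩ := hex
    have hcond : Q.erase w₀ ∈ thinMembers M 5 G ∧ 5 ≤ (Q.erase w₀ \ coloops M G).card ∧
        w₀ ∈ G \ clF M (Q.erase w₀) := by
      unfold faceLossP at hne0
      by_contra h
      rw [if_neg h] at hne0
      exact hne0 rfl
    have hloss : loss M 5 G (Q.erase w₀) w₀ ≠ 0 := by
      unfold faceLossP at hne0
      rwa [if_pos hcond] at hne0
    have hQeq : insert w₀ (Q.erase w₀) = Q := Finset.insert_erase hw₀
    have hcap := capS_ge_eleven_eighteenths_two_one hd hk hQG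
    have hsat : capS M 5 G Q < L1 M 5 G Q := by
      by_contra h
      push Not at h
      apply hloss
      unfold loss fS
      rw [hQeq, if_pos h]
      ring
    have hzeroK : ∀ w ∈ Q, w ∈ coloops M G →
        faceLossP M 5 G (fun B => 5 ≤ (B \ coloops M G).card) Q w = 0 := by
      intro w _ hwK
      unfold faceLossP
      rw [if_neg]
      rintro ⟨hthin, -, -⟩
      have := coloops_subset_of_mem_thinMembers hG hd' hthin hwK
      exact (Finset.notMem_erase w Q) this
    have hsum : ∑ w ∈ Q, faceLossP M 5 G (fun B => 5 ≤ (B \ coloops M G).card) Q w =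
        ∑ w ∈ Q \ coloops M G, faceLossP M 5 G (fun B => 5 ≤ (B \ coloops M G).card) Q w := by
      symm
      apply Finset.sum_subset Finset.sdiff_subset
      intro w hw hwn
      have hwK : w ∈ coloops M G := by
        by_contra h
        exact hwn (Finset.mem_sdiff.2 ⟨hw, h⟩)
      exact hzeroK w hw hwK
    have hle := Finset.sum_le_sum (fun w (_ : w ∈ Q \ coloops M G) =>
      faceLossP_le_faceLoss (P := fun B => 5 ≤ (B \ coloops M G).card) hG hd' Q w)
    have hL := sum_faceLoss_le_L1_mul hG hd' Q
    have hfS : fS M 5 G Q = capS M 5 G Q / L1 M 5 G Q := by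
      unfold fS
      rw [if_neg (not_le.2 hsat)]
    have hL1pos : 0 < L1 M 5 G Q := by linarith
    have hexc : L1 M 5 G Q * (1 - fS M 5 G Q) = L1 M 5 G Q - capS M 5 G Q := by
      rw [hfS]; field_simp
    rw [hsum]
    linarith
  · push Not at hex
    rw [Finset.sum_eq_zero hex]
    norm_num

end GeneralStructure

end PercRepro.Shadow
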